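import Summits.QuantumFields.YangMills.Theorems.SpecificationCompactnessScheffeUnbounded
import Literature.Analysis.FunctionSpaces.WeakCompactnessL1Proofs

/-!
# Route `SpecificationCompactness`, LINE 14 «tail_trivial_kernel» — weak-`L¹` limits of DLR-merging densities are DLR
# (route-independent support for `TailTrivialUniqueness`, stmt-QuantumFields-22690)

Abstract setting: `(X, m0, π)` a probability space, `m ≤ m0`, a measurable profile `q ≥ 0` with `π[q|m] = 1` a.e., and
densities `u_K ≥ 0` (measurable, integrable).

* `uniformIntegrable_of_tail`, `unifTight_one_of_isFiniteMeasure`, `UniformIntegrable.comp_seq`: the item's uniform-integrability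
  clause `∫ (u_K − M)₊ ≤ ε (K ≥ K₀)` packaged as Mathlib's `UniformIntegrable u 1 π` (+ trivial tightness), the input of the
  tree's Dunford–Pettis theorem `exists_subseq_tendstoWeaklyL1_of_stronglyMeasurable`.
* `exists_adjoint_multiplier`: for a bounded measurable `φ` there is a bounded `m`-measurable `ψ` with
  `∫ π[v|m]·q·φ dπ = ∫ v·ψ dπ` for EVERY integrable `v` (`ψ` = a bounded version of `π[qφ|m]`; the unbounded pull-out is the
  landed `integrable_condExp_mul_and_integral_eq`).
* `dlr_of_tendstoWeaklyL1`: if `∫ |u_K − π[u_K|m]·q| → 0` and `u_K ⇀ g` weakly in `L¹`, then `g = π[g|m]·q` a.e.; also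
  `nonneg_of_tendstoWeaklyL1`, `integral_eq_of_tendstoWeaklyL1`.

HONEST FRAMING: measure theory only [folklore] ([cite: FonsecaLeoni2007, Thm 2.54] for Dunford–Pettis; Georgii's DLR pattern);
nothing about the YM mass gap, no rung and no summit statement is proved here.  No definitions, no named facts.
-/

noncomputable section

namespace Summit.QuantumFields.YangMills.Theorems.SpecificationCompactnessWeakLimit

open MeasureTheory Filter Topology Set Function
open scoped ENNReal NNReal
open Literature.Analysis.FunctionSpaces
open Summit.QuantumFields.YangMills.Theorems.SpecificationCompactnessKernel
open Summit.QuantumFields.YangMills.Theorems.SpecificationCompactnessDensityMerging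

variable {X : Type*} {m m0 : MeasurableSpace X} {π : Measure X}

/-! ## §1 Uniform integrability packaging -/

/-- `‖1_s u‖_{L¹} = ∫_s u` for `u ≥ 0` integrable. [folklore] -/
theorem eLpNorm_one_indicator_eq_ofReal {u : X → ℝ} (hu0 : ∀ x, 0 ≤ u x) (hui : Integrable u π) {s : Set X}
    (hs : MeasurableSet s) : eLpNorm (s.indicator u) 1 π = ENNReal.ofReal (∫ x in s, u x ∂π) := by
  rw [eLpNorm_one_eq_lintegral_enorm]
  have h1 : (fun x => ‖s.indicator u x‖ₑ) = s.indicator (fun x => ‖u x‖ₑ) := by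
    funext x
    by_cases hx : x ∈ s
    · simp [hx]
    · simp [hx]
  rw [h1, lintegral_indicator hs]
  have h2 : ∀ x, ‖u x‖ₑ = ENNReal.ofReal (u x) := fun x => Real.enorm_of_nonneg (hu0 x)
  simp_rw [h2]
  exact (ofReal_integral_eq_lintegral_ofReal hui.integrableOn (Eventually.of_forall fun x => hu0 x)).symm

/-- `∫_s u ≤ M·π(s) + ∫ (u − M)₊` for `M ≥ 0`. [folklore] -/
theorem setIntegral_le_of_level [IsFiniteMeasure π] {u : X → ℝ} (hui : Integrable u π) (M : ℝ)
    (s : Set X) : ∫ x in s, u x ∂π ≤ M * π.real s + ∫ x, max (u x - M) 0 ∂π := by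
  have hpi : Integrable (fun x => max (u x - M) 0) π := (hui.sub (integrable_const M)).pos_part
  have hle : ∀ x, u x ≤ M + max (u x - M) 0 := fun x => by linarith [le_max_left (u x - M) 0]
  calc ∫ x in s, u x ∂π ≤ ∫ x in s, (M + max (u x - M) 0) ∂π :=
        setIntegral_mono hui.integrableOn ((integrable_const _).add hpi).integrableOn hle
    _ = M * π.real s + ∫ x in s, max (u x - M) 0 ∂π := by
        rw [integral_add (integrable_const _).integrableOn hpi.integrableOn, setIntegral_const, smul_eq_mul, mul_comm]
    _ ≤ M * π.real s + ∫ x, max (u x - M) 0 ∂π := by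
        have := setIntegral_le_integral (s := s) hpi (Eventually.of_forall fun x => le_max_right _ _)
        linarith

/-- **THE ITEM'S UI CLAUSE ⇒ MATHLIB's `UniformIntegrable … 1`** (on a probability space; the finitely many densities before
`K₀` are uniformly integrable on their own). [folklore] -/
theorem uniformIntegrable_of_tail [IsProbabilityMeasure π] {u : ℕ → X → ℝ} (hu : ∀ K, Measurable (u K))
    (hu0 : ∀ K x, 0 ≤ u K x) (hui : ∀ K, Integrable (u K) π)
    (hUI : ∀ ε : ℝ, 0 < ε → ∃ (M : ℝ) (K₀ : ℕ), ∀ K, K₀ ≤ K → ∫ x, max (u K x - M) 0 ∂π ≤ ε) :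
    UniformIntegrable u 1 π := by
  refine ⟨fun K => (hu K).aestronglyMeasurable, ?_, ?_⟩
  · intro ε hε
    obtain ⟨M, K₀, hM⟩ := hUI (ε / 2) (by positivity)
    set M' : ℝ := max M 0 with hM'
    have hM'0 : 0 ≤ M' := le_max_right _ _
    have hM'le : ∀ K, K₀ ≤ K → ∫ x, max (u K x - M') 0 ∂π ≤ ε / 2 := fun K hK => by
      refine le_trans (integral_mono_of_nonneg (Eventually.of_forall fun x => le_max_right _ _)
        (((hui K).sub (integrable_const M)).pos_part) (Eventually.of_forall fun x => ?_)) (hM K hK)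
      exact max_le_max (sub_le_sub_left (le_max_left M 0) _) le_rfl
    have hfin : UnifIntegrable (fun i : Fin K₀ => u i) 1 π :=
      unifIntegrable_finite le_rfl ENNReal.one_ne_top (fun i => memLp_one_iff_integrable.mpr (hui i))
    obtain ⟨δ₁, hδ₁, hδ₁'⟩ := hfin hε
    refine ⟨min δ₁ (ε / (2 * (M' + 1))), lt_min hδ₁ (by positivity), fun K s hs hμs => ?_⟩
    by_cases hK : K < K₀
    · exact hδ₁' ⟨K, hK⟩ s hs (hμs.trans (ENNReal.ofReal_le_ofReal (min_le_left _ _)))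
    · rw [not_lt] at hK
      rw [eLpNorm_one_indicator_eq_ofReal (hu0 K) (hui K) hs]
      apply ENNReal.ofReal_le_ofReal
      have hreal : π.real s ≤ ε / (2 * (M' + 1)) := by
        have h := hμs.trans (ENNReal.ofReal_le_ofReal (min_le_right _ _))
        rw [measureReal_def]
        exact (ENNReal.le_ofReal_iff_toReal_le (measure_ne_top π s) (by positivity)).mp h
      have hB := setIntegral_le_of_level (hui K) M' s
      have h2 : M' * π.real s ≤ ε / 2 := by
        have hfrac : M' / (M' + 1) ≤ 1 := (div_le_one (by positivity)).mpr (by linarith)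
        calc M' * π.real s ≤ M' * (ε / (2 * (M' + 1))) := mul_le_mul_of_nonneg_left hreal hM'0
          _ = (ε / 2) * (M' / (M' + 1)) := by field_simp
          _ ≤ ε / 2 := mul_le_of_le_one_right (by positivity) hfrac
      linarith [hM'le K hK]
  · obtain ⟨M₁, K₁, hM₁⟩ := hUI 1 one_pos
    set A : ℝ := max M₁ 0 + 1 with hA
    have hmass : ∀ K, K₁ ≤ K → ∫ x, u K x ∂π ≤ A := by
      intro K hK
      have h := setIntegral_le_of_level (hui K) (max M₁ 0) (Set.univ : Set X)
      rw [setIntegral_univ, probReal_univ, mul_one] at h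
      have h' : ∫ x, max (u K x - max M₁ 0) 0 ∂π ≤ 1 := by
        refine le_trans (integral_mono_of_nonneg (Eventually.of_forall fun x => le_max_right _ _)
          (((hui K).sub (integrable_const M₁)).pos_part) (Eventually.of_forall fun x => ?_)) (hM₁ K hK)
        exact max_le_max (sub_le_sub_left (le_max_left M₁ 0) _) le_rfl
      rw [hA]; linarith
    set C : ℝ := A + ∑ K ∈ Finset.range K₁, ∫ x, u K x ∂π with hC
    have hC0 : 0 ≤ C := by
      have : 0 ≤ ∑ K ∈ Finset.range K₁, ∫ x, u K x ∂π :=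
        Finset.sum_nonneg fun K _ => integral_nonneg (hu0 K)
      rw [hC, hA]; positivity
    refine ⟨C.toNNReal, fun K => ?_⟩
    have hK : ∫ x, u K x ∂π ≤ C := by
      by_cases h : K₁ ≤ K
      · have : 0 ≤ ∑ K ∈ Finset.range K₁, ∫ x, u K x ∂π :=
          Finset.sum_nonneg fun K _ => integral_nonneg (hu0 K)
        linarith [hmass K h]
      · rw [not_le] at h
        have hmem : K ∈ Finset.range K₁ := Finset.mem_range.mpr h
        have := Finset.single_le_sum (f := fun K => ∫ x, u K x ∂π) (fun K _ => integral_nonneg (hu0 K)) hmem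
        have hA0 : 0 ≤ A := by rw [hA]; positivity
        linarith
    have h1 : eLpNorm (u K) 1 π = ENNReal.ofReal (∫ x, u K x ∂π) := by
      have := eLpNorm_one_indicator_eq_ofReal (hu0 K) (hui K) MeasurableSet.univ
      rwa [Set.indicator_univ, setIntegral_univ] at this
    rw [h1]
    exact (ENNReal.ofReal_le_ofReal hK : ENNReal.ofReal _ ≤ ENNReal.ofReal C)

/-- On a finite measure space every sequence is uniformly tight (take the whole space). [folklore] -/
theorem unifTight_one_of_isFiniteMeasure [IsFiniteMeasure π] (f : ℕ → X → ℝ) : UnifTight f 1 π := by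
  intro ε hε
  exact ⟨Set.univ, measure_ne_top π _, fun i => by simp⟩

/-- Uniform integrability passes to reindexed families. [folklore] -/
theorem uniformIntegrable_comp_seq {u : ℕ → X → ℝ} (h : UniformIntegrable u 1 π) (ns : ℕ → ℕ) :
    UniformIntegrable (u ∘ ns) 1 π := by
  obtain ⟨h1, h2, C, hC⟩ := h
  refine ⟨fun i => h1 (ns i), fun ε hε => ?_, C, fun i => hC (ns i)⟩
  obtain ⟨δ, hδ, h'⟩ := h2 hε
  exact ⟨δ, hδ, fun i s hs hμ => h' (ns i) s hs hμ⟩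

/-! ## §2 The adjoint multiplier of `v ↦ ∫ π[v|m]·q·φ` -/

/-- `|π[v|m]| ≤ π[|v| |m]` a.e. [folklore] -/
theorem abs_condExp_le_condExp_abs {v : X → ℝ} (hv : Integrable v π) :
    ∀ᵐ x ∂π, |π[v|m] x| ≤ π[(fun y => |v y|)|m] x := by
  have h1 : π[v|m] ≤ᵐ[π] π[(fun y => |v y|)|m] := condExp_mono hv hv.abs (Eventually.of_forall fun x => le_abs_self _)
  have h2 : π[fun y => -v y|m] ≤ᵐ[π] π[(fun y => |v y|)|m] :=
    condExp_mono hv.neg hv.abs (Eventually.of_forall fun x => neg_le_abs _)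
  have h3 : π[fun y => -v y|m] =ᵐ[π] fun x => -π[v|m] x := by
    have := condExp_neg (μ := π) v m
    filter_upwards [this] with x hx
    exact hx
  filter_upwards [h1, h2, h3] with x hx1 hx2 hx3
  rw [hx3] at hx2
  exact abs_le.mpr ⟨by linarith, hx1⟩

/-- **ADJOINT MULTIPLIER.**  For a bounded measurable `φ` (`|φ| ≤ C`) there is a bounded `m`-measurable `ψ` (`|ψ| ≤ C`; a bounded
version of `π[q·φ|m]`) with `∫ π[v|m]·q·φ dπ = ∫ v·ψ dπ` for EVERY integrable `v` — the unbounded factors are handled by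
`integrable_condExp_mul_and_integral_eq`. [folklore] -/
theorem exists_adjoint_multiplier (hm : m ≤ m0) [IsFiniteMeasure π] {q : X → ℝ} (hq : Measurable q)
    (hq0 : ∀ x, 0 ≤ q x) (hq1 : ∀ᵐ x ∂π, π[q|m] x = 1) (hqi : Integrable q π)
    {φ : X → ℝ} (hφ : Measurable φ) {C : ℝ} (hC0 : 0 ≤ C) (hφC : ∀ x, |φ x| ≤ C) :
    ∃ ψ : X → ℝ, StronglyMeasurable[m] ψ ∧ (∀ x, |ψ x| ≤ C) ∧
      ∀ v : X → ℝ, Integrable v π → ∫ x, π[v|m] x * q x * φ x ∂π = ∫ x, v x * ψ x ∂π := by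
  -- `h = q φ`, `ψ₀ = π[h|m]`, `|ψ₀| ≤ C` a.e.
  set h : X → ℝ := fun x => q x * φ x with hh
  have hhi : Integrable h π :=
    (integrable_bdd_mul_left hqi hφ.aestronglyMeasurable hφC).congr
      (Eventually.of_forall fun x => by show φ x * q x = h x; simp [hh, mul_comm])
  have hψ₀m : Measurable[m] (π[h|m]) := stronglyMeasurable_condExp.measurable
  have hcq : π[fun x => C * q x|m] =ᵐ[π] fun x => C * π[q|m] x := by
    have h1 : (fun x => C * q x) = C • q := by funext x; simp [smul_eq_mul]
    rw [h1]
    filter_upwards [condExp_smul (μ := π) C q m] with x hx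
    simpa [smul_eq_mul] using hx
  have hCqi : Integrable (fun x => C * q x) π := hqi.const_mul C
  have hup : (π[h|m]) ≤ᵐ[π] π[fun x => C * q x|m] :=
    condExp_mono hhi hCqi (Eventually.of_forall fun x => by
      show q x * φ x ≤ C * q x
      have := (abs_le.mp (hφC x)).2
      nlinarith [hq0 x])
  have hdown : π[fun x => -h x|m] ≤ᵐ[π] π[fun x => C * q x|m] :=
    condExp_mono hhi.neg hCqi (Eventually.of_forall fun x => by
      show -(q x * φ x) ≤ C * q x
      have := (abs_le.mp (hφC x)).1
      nlinarith [hq0 x])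
  have hneg : π[fun x => -h x|m] =ᵐ[π] fun x => -π[h|m] x := by
    have := condExp_neg (μ := π) h m
    filter_upwards [this] with x hx
    exact hx
  have hψ₀C : ∀ᵐ x ∂π, |π[h|m] x| ≤ C := by
    filter_upwards [hup, hdown, hneg, hcq, hq1] with x h1 h2 h3 h4 h5
    rw [h4, h5, mul_one] at h1 h2
    rw [h3] at h2
    exact abs_le.mpr ⟨by linarith, h1⟩
  -- the bounded version
  set ψ : X → ℝ := fun x => max (-C) (min C (π[h|m] x)) with hψ
  have hψm : Measurable[m] ψ :=
    (@measurable_const _ _ _ m (-C)).max ((@measurable_const _ _ _ m C).min hψ₀m)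
  have hψsm : StronglyMeasurable[m] ψ := hψm.stronglyMeasurable
  have hψC : ∀ x, |ψ x| ≤ C := fun x => abs_max_neg_min_le hC0 _
  have hψae : ψ =ᵐ[π] π[h|m] := hψ₀C.mono fun x hx => max_neg_min_eq_self hx
  refine ⟨ψ, hψsm, hψC, fun v hv => ?_⟩
  -- integrability of `π[v|m]·h`
  obtain ⟨habsqi, -⟩ := integrable_condExp_mul_and_integral_eq (u := fun y => |v y|) hm hq hq0 hq1 hqi
  have hint : Integrable (π[v|m] * h) π := by
    refine (habsqi.const_mul C).mono' ((stronglyMeasurable_condExp.mono hm).aestronglyMeasurable.mul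
      hhi.aestronglyMeasurable) ?_
    filter_upwards [abs_condExp_le_condExp_abs (m := m) hv, condExp_nonneg (μ := π) (m := m)
      (f := fun y => |v y|) (Eventually.of_forall fun y => abs_nonneg _)] with x hx hx0
    show ‖π[v|m] x * h x‖ ≤ C * (π[(fun y => |v y|)|m] x * q x)
    rw [Real.norm_eq_abs, abs_mul, hh]
    simp only
    rw [abs_mul, abs_of_nonneg (hq0 x)]
    have hφx := hφC x
    have hqx := hq0 x
    calc |π[v|m] x| * (q x * |φ x|) ≤ π[(fun y => |v y|)|m] x * (q x * C) := by
          gcongr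
      _ = C * (π[(fun y => |v y|)|m] x * q x) := by ring
  have hpull : π[π[v|m] * h|m] =ᵐ[π] π[v|m] * π[h|m] :=
    condExp_mul_of_stronglyMeasurable_left stronglyMeasurable_condExp hint hhi
  calc ∫ x, π[v|m] x * q x * φ x ∂π = ∫ x, (π[v|m] * h) x ∂π := by
        refine integral_congr_ae (Eventually.of_forall fun x => ?_)
        show π[v|m] x * q x * φ x = π[v|m] x * (q x * φ x); ring
    _ = ∫ x, π[π[v|m] * h|m] x ∂π := (integral_condExp hm).symm
    _ = ∫ x, π[v|m] x * ψ x ∂π := by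
        refine integral_congr_ae ?_
        filter_upwards [hpull, hψae] with x hx hψx
        rw [hx, hψx]; rfl
    _ = ∫ x, v x * ψ x ∂π := (integral_mul_eq_integral_condExp_mul hm hv hψsm hψC).symm

/-! ## §3 Weak-`L¹` limits -/

/-- A weak-`L¹` limit of non-negative functions is non-negative a.e. [folklore] -/
theorem nonneg_of_tendstoWeaklyL1 {u : ℕ → X → ℝ} (hu0 : ∀ K x, 0 ≤ u K x) {g : X → ℝ} (hgi : Integrable g π)
    (hweak : TendstoWeaklyL1 u g π) : 0 ≤ᵐ[π] g := by
  refine ae_nonneg_of_forall_setIntegral_nonneg hgi fun s hs _ => ?_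
  have h := hweak (s.indicator fun _ => (1:ℝ)) 1 ((measurable_const.indicator hs).aestronglyMeasurable)
    (Eventually.of_forall fun x => by by_cases hx : x ∈ s <;> simp [hx])
  have h1 : ∀ K, 0 ≤ ∫ x, u K x * s.indicator (fun _ => (1:ℝ)) x ∂π := fun K =>
    integral_nonneg fun x => mul_nonneg (hu0 K x) (Set.indicator_nonneg (fun _ _ => zero_le_one) _)
  have h2 : ∫ x, g x * s.indicator (fun _ => (1:ℝ)) x ∂π = ∫ x in s, g x ∂π := by
    rw [← integral_indicator hs]
    refine integral_congr_ae (Eventually.of_forall fun x => ?_)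
    by_cases hx : x ∈ s <;> simp [hx]
  rw [← h2]
  exact ge_of_tendsto' h h1

/-- A weak-`L¹` limit keeps the total mass. [folklore] -/
theorem integral_eq_of_tendstoWeaklyL1 {u : ℕ → X → ℝ} {c : ℝ} (hu1 : ∀ K, ∫ x, u K x ∂π = c) {g : X → ℝ}
    (hweak : TendstoWeaklyL1 u g π) : ∫ x, g x ∂π = c := by
  have h := hweak (fun _ => (1:ℝ)) 1 aestronglyMeasurable_const (Eventually.of_forall fun x => by simp)
  simp only [mul_one] at h
  have h' : Tendsto (fun K : ℕ => ∫ x, u K x ∂π) atTop (𝓝 c) := by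
    simp_rw [hu1]; exact tendsto_const_nhds
  exact tendsto_nhds_unique h h'

/-- **WEAK-`L¹` LIMITS OF DLR-MERGING DENSITIES ARE DLR.**  If `∫ |u_K − π[u_K|m]·q| dπ → 0` and `u_K ⇀ g` weakly in `L¹(π)`
(`g` integrable), then `g = π[g|m]·q` a.e. [folklore] -/
theorem dlr_of_tendstoWeaklyL1 (hm : m ≤ m0) [IsProbabilityMeasure π]
    {u : ℕ → X → ℝ} (hui : ∀ K, Integrable (u K) π)
    {q : X → ℝ} (hq : Measurable q) (hq0 : ∀ x, 0 ≤ q x) (hq1 : ∀ᵐ x ∂π, π[q|m] x = 1)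
    (hmerge : Tendsto (fun K => ∫ x, |u K x - π[u K|m] x * q x| ∂π) atTop (𝓝 0))
    {g : X → ℝ} (hgi : Integrable g π) (hweak : TendstoWeaklyL1 u g π) :
    g =ᵐ[π] fun x => π[g|m] x * q x := by
  have hqi : Integrable q π := integrable_of_condExp_ae_eq_one hq1
  obtain ⟨hgqi, -⟩ := integrable_condExp_mul_and_integral_eq (u := g) hm hq hq0 hq1 hqi
  refine Integrable.ae_eq_of_forall_setIntegral_eq _ _ hgi hgqi (fun s hs _ => ?_)
  -- test against `φ = 1_s`
  set φ : X → ℝ := s.indicator fun _ => (1:ℝ) with hφ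
  have hφm : Measurable φ := measurable_const.indicator hs
  have hφC : ∀ x, |φ x| ≤ 1 := fun x => by by_cases hx : x ∈ s <;> simp [hφ, hx]
  obtain ⟨ψ, hψm, hψC, hadj⟩ := exists_adjoint_multiplier hm hq hq0 hq1 hqi hφm zero_le_one hφC
  -- indicator integrals
  have hind : ∀ w : X → ℝ, ∫ x in s, w x ∂π = ∫ x, w x * φ x ∂π := fun w => by
    rw [← integral_indicator hs]
    refine integral_congr_ae (Eventually.of_forall fun x => ?_)
    by_cases hx : x ∈ s <;> simp [hφ, hx]
  rw [hind g, hind (fun x => π[g|m] x * q x)]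
  -- the two weak limits
  have hA : Tendsto (fun K => ∫ x, u K x * φ x ∂π) atTop (𝓝 (∫ x, g x * φ x ∂π)) :=
    hweak φ 1 hφm.aestronglyMeasurable (Eventually.of_forall hφC)
  have hB : Tendsto (fun K => ∫ x, u K x * ψ x ∂π) atTop (𝓝 (∫ x, g x * ψ x ∂π)) :=
    hweak ψ 1 (hψm.mono hm).aestronglyMeasurable (Eventually.of_forall hψC)
  -- their difference tends to `0` by the merging hypothesis
  have hdiff : Tendsto (fun K => ∫ x, u K x * φ x ∂π - ∫ x, u K x * ψ x ∂π) atTop (𝓝 0) := by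
    refine squeeze_zero_norm (fun K => ?_) hmerge
    obtain ⟨hcqi, -⟩ := integrable_condExp_mul_and_integral_eq (u := u K) hm hq hq0 hq1 hqi
    have hi1 : Integrable (fun x => u K x * φ x) π :=
      (integrable_bdd_mul_left (hui K) hφm.aestronglyMeasurable hφC).congr
        (Eventually.of_forall fun x => by show φ x * u K x = u K x * φ x; ring)
    have hi2 : Integrable (fun x => π[u K|m] x * q x * φ x) π :=
      (integrable_bdd_mul_left hcqi hφm.aestronglyMeasurable hφC).congr
        (Eventually.of_forall fun x => by show φ x * (π[u K|m] x * q x) = π[u K|m] x * q x * φ x; ring)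
    rw [← hadj (u K) (hui K), ← integral_sub hi1 hi2, Real.norm_eq_abs]
    calc |∫ x, (u K x * φ x - π[u K|m] x * q x * φ x) ∂π|
        ≤ ∫ x, |u K x * φ x - π[u K|m] x * q x * φ x| ∂π := abs_integral_le_integral_abs
      _ ≤ ∫ x, |u K x - π[u K|m] x * q x| ∂π := by
          refine integral_mono_of_nonneg (Eventually.of_forall fun x => abs_nonneg _)
            ((hui K).sub hcqi).abs (Eventually.of_forall fun x => ?_)
          show |u K x * φ x - π[u K|m] x * q x * φ x| ≤ |u K x - π[u K|m] x * q x|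
          rw [← sub_mul, abs_mul]
          exact mul_le_of_le_one_right (abs_nonneg _) (hφC x)
  have hlim : ∫ x, g x * φ x ∂π - ∫ x, g x * ψ x ∂π = 0 := tendsto_nhds_unique (hA.sub hB) hdiff
  rw [hadj g hgi]
  linarith

end Summit.QuantumFields.YangMills.Theorems.SpecificationCompactnessWeakLimit

end
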